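import Literature.MathematicalPhysics.QuantumFieldTheory.BalabanImbrieJaffe1984to88.BIJ88Eq542Torus
import Literature.MathematicalPhysics.QuantumFieldTheory.BalabanImbrieJaffe1984to88.BIJ85Ineq722Torus

/-!
# `BalabanImbrieJaffe1984to88.BIJ88Eq5410Torus` — T. Bałaban, J. Imbrie, A. Jaffe, *Effective action and cluster properties of the abelian
Higgs model*, Commun. Math. Phys. **114** (1988) 257–315 [BalabanImbrieJaffe1988], Sect. 5.4 p. 283 [PDF 27]: **(5.4.8)** (the whole-torus form
of (5.3.4)), **(5.4.9)** (the split of the bracket at `Λ₃^{(k)*}`, with the kernel `w₅`) and **(5.4.10)** (the background gauge field for the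
normalization factors, after gauging away `∂C_kΛ₃^{(k)*}A′`) — ON THE TORUS CARRIER OF RECORD (kind «model instance»); and (§0) the cube ∕ collar
geometry of p. 281 in the torus `ℓ^∞` distance, discharging the range hypothesis of the companion file's (5.4.2).

statement-level skeleton of published theorems with citation tags; proofs where landed; nothing here is a claim about the Yang–Mills mass gap

PDF held: `paper:balaban1988-cmp114-bij-abelian-higgs-effective-action` (journal page = PDF page + 256); p. 283 [PDF 27] =
`HOME/lit-balaban-r16/renders/cmp114/original-p027-x2.png` read as an image this session; p. 281 [PDF 25] (seat folder
`renders/original-p025-x2.png`).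

CITATION HEADER (lean-in-tree rule).  Part of the lit-balaban TYPED SKELETON (HOME `run/shared/lean/pub/lit-balaban/`), PHASE-2 proof seat p31
gen 7 (unit `lit-balaban-p31-g7`; TAKING line HOME/STATUS.md 2026-08-21T11:48Z; second file of the gen after `BIJ88Eq542Torus`).  WHAT IS
REPRODUCED: row `C2.Eq5.4.8-5.4.10` of `HOME/lit-balaban-r16/ROWS-C2-part2.md` (owner r16) — members (5.4.8) and (5.4.10) (recorded there as
*"`bgExp` instances, reader level"*) and (5.4.9) (r16's ring identities `BIJ88Sect5StatementsPart3.eq549_split`/`eq549`, corrected sign of `w₅`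
per transcript note T8, here read on functions for the concrete `Q^{s*}_k`); row `C2.Eq5.4.1-5.4.6`, the p. 281 collar sentence in metric form.

THE PRINTED TEXT (verbatim, p. 283).  *"The Gaussian normalization factors Z^{(j)}_{Λ^{(j)}_{10}}(u_k) are intrinsically nonlocal objects … Thus at
this point we must resign from a local form of the gauge transformation. Recall from (5.3.4) that u_k has been written as
(Λ̄₂^{(k)*c}u_k)(Λ̄₂^{(k)*}Q^{s*}_{k+1}v) exp ie_kηΛ̄₂^{(k)*}(Q^{s*}_kA′ − 𝒟_{k,loc}∂*Q^{e*}_k(∂A′ + L^{−2}Q^{e*}f)). (5.4.8) We put Λ̄₂^{(k)*}(Q^{s*}_k −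
𝒟_{k,loc}∂*Q^{e*}_k∂)A′ = Λ̄₂^{(k)*}(Q^{s*}_k − 𝒟_{k,loc}∂*Q^{e*}_k∂)Λ₃^{(k)*c}A′ + (Q^{s*}_k − 𝒟_{k,loc}∂*Q^{e*}_k∂)Λ₃^{(k)*}A′ = Λ̄₂^{(k)*}(Q^{s*}_k −
𝒟_{k,loc}∂*Q^{e*}_k∂)Λ₃^{(k)*c}A′ + H_{k,loc}Λ₃^{(k)*}A′ + ∂C_kΛ₃^{(k)*}A′ + w₅A′. (5.4.9) Here w₅ = [(𝒟_{k,loc} − 𝒟_k)∂*Q^{e*}_k∂ + H_k −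
H_{k,loc}]Λ₃^{(k)*} is another small, exponentially decaying kernel. We can gauge away the term ∂C_kΛ₃^{(k)*}A′, leaving us with the following
background gauge field for the normalization factors: (Λ̄₂^{(k)*c}u_k)(Λ̄₂^{(k)*}Q^{s*}_{k+1}v) exp ie_kη[Λ̄₂^{(k)*}(Q^{s*}_k − 𝒟_{k,loc}∂Q^{e*}_k∂)
Λ₃^{(k)*c}A′ − L^{−2}Λ̄₂^{(k)*}𝒟_{k,loc}∂*Q^{e*}_{k+1}f + H_{k,loc}Λ₃^{(k)*}A′ + w₅A′]. (5.4.10) The term w₅A′ will be removed later on; it couples A′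
to bonds everywhere in T_η."*

WHAT THESE ARE, and what is data.  (5.4.8) is gen 6's `BIJ88Eq533Torus.eq533_inside` ((5.3.3) inside `Λ̄₁^{(k)*}`; (5.3.4) under the locality
`hT`) written as an identity on ALL of `T_η` with the cut-offs explicit: OUTSIDE `Λ̄₂^{(k)*}` the right side is `u_k` itself (`Λ̄₂^{*c}u_k`, the
other two factors being `1`), INSIDE it is (5.3.4); `Λ̄₂^{(k)} = blockUnion (k+1) X₂` for block sites `X₂ ⊆ X` (`Λ₂ ⊂ Λ₁`, p. 274), group-valued
cut-offs = gen 6's `cutoffG`, real cut-offs = `Set.indicator`.  (5.4.9) is linear algebra from (5.4.1) = (2.20) (hypothesis `h541` on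
functions, as in `BIJ88Eq542Torus.eq544_torus`) and ONE range law — r16's `Λ̄₂^{(k)*}XΛ₃^{(k)*} = XΛ₃^{(k)*}` — here `hrange`: the bond function
`(Q^{s*}_k − T_loc∂)(Λ₃*A′)` vanishes off `Λ̄₂*` (and `rangeLaw_of_range` DERIVES it from a range relation for `T_loc` plus the collar separation
of `Λ₃` inside `Λ₂`).  (5.4.10) = the (4.16)/(5.4.5)-type background gauge transformation (r18's `bgGaugeU`) with the NONLOCAL gauge function
`λ = C_k(Λ₃*A′)` applied to (5.4.8) with (5.4.9) inserted: INSIDE `Λ̄₂*` the bracket loses `∂C_kΛ₃*A′` (r16's `bgGaugeU_bgExp`), OUTSIDE `Λ̄₂*` the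
new exponent `H_{k,loc}Λ₃*A′ + w₅A′` equals `(Q^{s*}_k − T_loc∂)(Λ₃*A′) − ∂C_k(Λ₃*A′) = −∂C_k(Λ₃*A′)` by the range law — which is why (5.4.10) holds
at EVERY bond of `T_η` although the gauge function is not localized (*"it couples A′ to bonds everywhere in T_η"*).  Data: `T_k = 𝒟_k∂*Q^{e*}_k`,
`T_loc = 𝒟_{k,loc}∂*Q^{e*}_k`, `H_k`, `H_{k,loc}`, `C_k`, `Q^{e*} = Qes` linear maps; `Q^{s*}_k` = the concrete real pull-back
`(torusBlockBondsIter P i k).Qsstar`; `∂ = curl 1` on `T₁^{(k)}`, `∂^η = grad η⁻¹`; `Λ₃^{(k)*}` = a unit-lattice bond set `S`; `w₅A′ = (T_k −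
T_loc)∂(Λ₃*A′) + (H_k − H_{k,loc})(Λ₃*A′)` spelled out (r16's corrected sign; print has `(𝒟_{k,loc} − 𝒟_k)`).

CARRIERS (all of record): η-lattice = torus level `i`, unit lattice = level `i + k`, block lattice = level `i + k + 1` (standing range
`i + k + 1 ≤ m + K`); `LatticeFieldCalculus.supDist` = the `ℓ^∞` torus distance in lattice steps ([Balaban1982Higgs1] (1.3)), its triangle
inequality `BIJ85Ineq722Torus.supDist_triangle` (p09 gen 3).

WHAT IS PROVED (theorems only; 0 `sorry`, standard axioms, no `def`, no `Prop`-valued fact introduced).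
* §0 the p. 281 collar in the torus `ℓ^∞` distance: `supDist_corners_le`, **`starP_of_collar`** (a cube of radius `N ≥ N₀ + R + 2` about `x₀` contains in
  its plaquette star every plaquette within range `R` of the cube of radius `N₀` — *"□ is a ½r(e_k)-cube in T₁^{(k)*} containing a collar
  neighborhood around □₀"*), **`apply_curl_indicator_eq_of_supDist`** (for a `T` of `ℓ^∞` range `R`, `(T∂(□A′))(b) = (T∂A′)(b)` on `□₀`: the hypothesis
  `hdep` of `BIJ88Eq542Torus.eq542_torus` discharged).
* §1 **`eq548_torus`** ((5.4.8) at every η-bond: `u_k = (Λ̄₂^{*c}u_k)(Λ̄₂^{*}Q^{s*}_{k+1}v) exp ie_kη[Λ̄₂^{*}(Q^{s*}_kA′ − T_loc(∂A′ + L^{−2}Q^{e*}f))]`).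
* §2 `curl_indicator_compl_add`, **`eq549_torus`** ((5.4.9) at every η-bond from `h541` and `hrange`), **`rangeLaw_of_range`** (`hrange` from a range
  relation for `T_loc` and the separation of `Λ₃*` from the complement of `Λ̄₂*`).
* §3 **`eq5410_torus`** ((5.4.10) at EVERY η-bond: `bgGaugeU e_k η (C_k(Λ₃*A′)) u_k = (Λ̄₂^{*c}u_k)(Λ̄₂^{*}Q^{s*}_{k+1}v) exp ie_kη[Λ̄₂^{*}(Q^{s*}_k −
  T_loc∂)(Λ₃^{*c}A′) − L^{−2}Λ̄₂^{*}T_loc(Q^{e*}f) + H_{k,loc}(Λ₃*A′) + w₅A′]`).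
HONEST SCOPE.  Not here: the smallness of `w₅` (p08 gen 4's `BIJ88W5Bound549`), (5.4.1) for the concrete kernels (hypothesis `h541`; (2.20) on
the tori = p08 gen 7's `BIJ88Eq220Torus`, Euclidean carriers, not transferred), the specific radii of `Λ₂ ⊃ Λ₃` (the separation enters as the
hypotheses `hfarQ`/`hfarT` of `rangeLaw_of_range`, or as `hrange`), the later removal of `w₅A′`.  Imports: this seat's `BIJ88Eq542Torus` and
p09 gen 3's `BIJ85Ineq722Torus` (p252478; only `supDist_triangle`, `supDist_runSite_le` are used).  Unit `lit-balaban-p31`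
(literature-prover-lit-balaban-p31-g7-0), 2026-08-21.
-/

namespace Literature.MathematicalPhysics.QuantumFieldTheory.BalabanImbrieJaffe1984to88.BIJ88Eq5410Torus

open Literature.MathematicalPhysics.QuantumFieldTheory.Balaban1983to89
open BIJ88Sect3Statements (U1 toC toC_mul toC_one starB mem_starB starP)
open BIJ88Sect4Statements (backgroundU bgGaugeU)
open BIJ88Sect5StatementsPart3 (bgExp)
open BIJ85BlockAveragesTorus (expU1 surfMul)
open BIJ85Eq453GaugeField (qsstarGIter)
open BIJ85Eq224Proof (torusBlockBondsIter)
open BIJ88Eq536Linearization (cutoff)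
open BIJ88Eq533Torus (cutoffG cutoffG_of_mem cutoffG_of_not_mem blockUnion mem_blockUnion liftBonds mem_liftBonds eq533_torus
  eq533_inside Qsstar_indicator_of_mem_starB)
open BIJ88Eq542Torus (Qsstar_apply Qsstar_indicator Qsstar_indicator_compl_add curl_indicator_of_mem_starP blockUnion_mono
  apply_curl_indicator_eq_of_range)
open BIJ88Eq564Torus (starB_mono)
open B7SectAStatements (blockOfIter)
open LatticeFieldCalculus (grad curl curl_add supDist)
open BIJ85Ineq722Torus (supDist_triangle supDist_runSite_le)
open scoped BigOperators Real
open Complex Finset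

noncomputable section

variable {P : Params} {i : ℕ}

/-! ## §0 The cubes: *"□ is a ½r(e_k)-cube in T₁^{(k)*} containing a collar neighborhood around □₀"* (the `ℓ^∞` torus distance) -/

/-- kernel: one lattice step has `ℓ^∞` length at most `1`: `|x − (x + e_μ)|_∞ ≤ 1` (`LatticeFieldCalculus.supDist`, lattice steps; cf. the
private twin in `BIJ88Ineq217Ineq722Torus`). [cite: Balaban1982Higgs1, (1.3) p.604] -/
private theorem supDist_shift_le {n : ℕ} (x : Balaban1983to89.Site P n) (μ : Fin P.d) : supDist x (x.shift μ) ≤ 1 := by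
  have h := supDist_runSite_le x μ 1
  have e : LatticeFieldCalculus.runSite x μ 1 = x.shift μ := by
    simp [LatticeFieldCalculus.runSite, Balaban1983to89.Site.shift]
  rwa [e] at h

/-- kernel: the four corners of a plaquette lie within `ℓ^∞` distance `2` of its base point. [cite: Balaban1982Higgs1, (1.3) p.604] -/
theorem supDist_corners_le {n : ℕ} (p : Balaban1983to89.Plaq P n) :
    supDist p.src p.src ≤ 2 ∧ supDist p.src (p.src.shift p.μ) ≤ 2 ∧ supDist p.src (p.src.shift p.ν) ≤ 2 ∧
      supDist p.src ((p.src.shift p.μ).shift p.ν) ≤ 2 := by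
  refine ⟨?_, (supDist_shift_le _ _).trans (by norm_num), (supDist_shift_le _ _).trans (by norm_num), ?_⟩
  · rw [(B3TorusRadialSums.supDist_eq_zero_iff _ _).2 rfl]
    norm_num
  · exact (supDist_triangle _ (p.src.shift p.μ) _).trans (by linarith [supDist_shift_le p.src p.μ, supDist_shift_le (p.src.shift p.μ) p.ν])

/-- **The collar geometry, with the torus `ℓ^∞` distance.**  If the unit-lattice site set `X_□` contains the cube of radius `N` about `x₀`
(*"□ is a ½r(e_k)-cube"*), `x` lies in the cube of radius `N₀` about `x₀` (*"□₀"*), and `N₀ + R + 2 ≤ N` (*"containing a collar neighborhood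
around □₀"* of width at least the range `R`), then every plaquette within range `R` of `x` lies in `X_□**` — the hypothesis `hX` of
`apply_curl_indicator_eq_of_range` for the range relation `|x − p₋|_∞ ≤ R`. [cite: BalabanImbrieJaffe1988, (5.4.2) p.281] -/
theorem starP_of_collar {n : ℕ} (Xb : Finset (Balaban1983to89.Site P n)) (x₀ : Balaban1983to89.Site P n) {N N₀ R : ℕ}
    (hXb : ∀ y, supDist x₀ y ≤ N → y ∈ Xb) (hN : N₀ + R + 2 ≤ N) {x : Balaban1983to89.Site P n} (hx : supDist x₀ x ≤ N₀)
    {p : Balaban1983to89.Plaq P n} (hp : supDist x p.src ≤ R) : p ∈ BIJ88Sect3Statements.starP Xb := by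
  simp only [BIJ88Sect3Statements.starP, Finset.mem_filter, Finset.mem_univ, true_and]
  have hxp : supDist x₀ p.src ≤ N₀ + R := (supDist_triangle x₀ x p.src).trans (add_le_add hx hp)
  have key : ∀ c, supDist p.src c ≤ 2 → c ∈ Xb := fun c hc =>
    hXb c ((supDist_triangle x₀ p.src c).trans ((add_le_add hxp hc).trans hN))
  obtain ⟨h1, h2, h3, h4⟩ := supDist_corners_le p
  exact ⟨key _ h1, key _ h2, key _ h3, key _ h4⟩

/-- **… hence, for a map `T` of `ℓ^∞` RANGE `R`** (*"𝒟_{k,loc} has a range (1/2L)r(e_{k−1})"*: `(T F)(b)` depends only on the plaquettes `p` with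
`|B^k(b₋) − p₋|_∞ ≤ R` on the unit lattice) **the cut-off `□` is invisible at the bonds of `□₀`**: `(T∂(□A′))(b) = (T∂A′)(b)` whenever the k-block
of `b₋` lies in the cube `□₀` of radius `N₀` and `□ ⊇` the cube of radius `N ≥ N₀ + R + 2` about the same centre — the hypothesis `hdep` of
`BIJ88Eq542Torus.eq542_torus`, discharged (`∂` = the unit-lattice curl, any constant). [cite: BalabanImbrieJaffe1988, (5.4.2) p.281] -/
theorem apply_curl_indicator_eq_of_supDist {n : ℕ} {β : Type*} (T : (Balaban1983to89.Plaq P n → ℝ) → PBond P i → β) (R : ℕ)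
    (bk : PBond P i → Balaban1983to89.Site P n)
    (hT : ∀ (F₁ F₂ : Balaban1983to89.Plaq P n → ℝ) (b : PBond P i), (∀ p, supDist (bk b) p.src ≤ R → F₁ p = F₂ p) → T F₁ b = T F₂ b)
    (Xb : Finset (Balaban1983to89.Site P n)) (x₀ : Balaban1983to89.Site P n) {N N₀ : ℕ} (hXb : ∀ y, supDist x₀ y ≤ N → y ∈ Xb)
    (hN : N₀ + R + 2 ≤ N) {b : PBond P i} (hb : supDist x₀ (bk b) ≤ N₀) (c : ℝ) (A : PBond P n → ℝ) :
    T (curl c ((↑(starB Xb) : Set (PBond P n)).indicator A)) b = T (curl c A) b :=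
  apply_curl_indicator_eq_of_range T (fun b p => supDist (bk b) p.src ≤ R) (hT · · b) Xb
    (fun _ hp => starP_of_collar Xb x₀ hXb hN hb hp) c A

/-! ## §1 (5.4.8): the whole-torus form of (5.3.4) -/

/-- **(5.4.8) ON THE TORUS.**  p. 283 [PDF 27], verbatim: *"Recall from (5.3.4) that u_k has been written as (Λ̄₂^{(k)*c}u_k)(Λ̄₂^{(k)*}Q^{s*}_{k+1}v)
exp ie_kηΛ̄₂^{(k)*}(Q^{s*}_kA′ − 𝒟_{k,loc}∂*Q^{e*}_k(∂A′ + L^{−2}Q^{e*}f)). (5.4.8)"*  HERE: `u_k` = the background field (4.2) after the translation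
(5.3.1) (gen 6's `eq533_torus`; data `u′ = e^{ie_kA′}` on `Λ₁^{(k)*}`, `v`, `g = 𝒟_{k,loc}∂*Q^{e*}_kf^{(k)}`, `ηL^k = 1`), `Λ̄₂^{(k)} = blockUnion (k+1) X₂` for block
sites `X₂ ⊆ X` (Λ₂ ⊂ Λ₁, p. 274), the cut-offs of group-valued fields gen 6's `cutoffG`, of the real bracket the indicator; `T = 𝒟_{k,loc}∂*Q^{e*}_k`,
`Q^{e*} = Qes` data, `∂ = curl 1`; HYPOTHESIS `hT` = the (5.3.4) locality on `Λ̄₂^{(k)*}` (gen 6).  CONCLUSION, at EVERY η-bond `b`: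
`u_k(b) = (Λ̄₂^{*c}u_k)(b) · (Λ̄₂^{*}Q^{s*}_{k+1}v)(b) · exp ie_kη[Λ̄₂^{*}(Q^{s*}_kA′ − T(∂A′ + L^{−2}Q^{e*}f))](b)` (standing range).
[cite: BalabanImbrieJaffe1988, (5.4.8) p.283] -/
theorem eq548_torus {k : ℕ} (hk : i + k + 1 ≤ P.m + P.K) {ek η : ℝ} (hη : η * (P.L : ℝ) ^ k = 1)
    (X : Finset (Balaban1983to89.Site P (i + k + 1))) {u' : GaugeField P (i + k) U1} {A' : PBond P (i + k) → ℝ}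
    (hu : ∀ c ∈ starB (blockUnion 1 X), u' c = expU1 (ek * A' c)) (v : GaugeField P (i + k + 1) U1) (g : PBond P i → ℝ)
    {Plc : Type*} (L : ℝ) (T : (Balaban1983to89.Plaq P (i + k) → ℝ) →ₗ[ℝ] (PBond P i → ℝ))
    (Qes : (Plc → ℝ) →ₗ[ℝ] (Balaban1983to89.Plaq P (i + k) → ℝ)) (f : Plc → ℝ)
    (X₂ : Finset (Balaban1983to89.Site P (i + k + 1))) (hX₂ : X₂ ⊆ X)
    (hT : ∀ b ∈ starB (blockUnion (k + 1) X₂), g b = T (curl 1 A' + L⁻¹ ^ 2 • Qes f) b) (b : PBond P i) :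
    backgroundU ek η (fun b => toC (qsstarGIter k (surfMul u' (cutoff (starB X) v)) b)) g b =
      cutoffG (starB (blockUnion (k + 1) X₂))ᶜ
          (backgroundU ek η (fun b => toC (qsstarGIter k (surfMul u' (cutoff (starB X) v)) b)) g) b *
        toC (cutoffG (starB (blockUnion (k + 1) X₂)) (qsstarGIter (k + 1) v) b) *
        Complex.exp (I * ((ek * η * (↑(starB (blockUnion (k + 1) X₂)) : Set (PBond P i)).indicator
          (fun b => (torusBlockBondsIter P i k).Qsstar A' b - T (curl 1 A' + L⁻¹ ^ 2 • Qes f) b) b : ℝ) : ℂ)) := by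
  by_cases hb : b ∈ starB (blockUnion (k + 1) X₂)
  · -- inside `Λ̄₂*` ⊆ `Λ̄₁*`: (5.3.4)
    have hb₁ : b ∈ starB (blockUnion (k + 1) X) := starB_mono (blockUnion_mono (k + 1) hX₂) hb
    rw [eq533_inside hk hη X hu v g hb₁, cutoffG_of_not_mem _ (fun h => (Finset.mem_compl.1 h) hb), one_mul,
      cutoffG_of_mem _ hb, Set.indicator_of_mem (Finset.mem_coe.2 hb), hT b hb]
  · -- outside `Λ̄₂*`: the prefactor is `u_k` itself and the other two factors are `1`
    rw [cutoffG_of_mem _ (Finset.mem_compl.2 hb), cutoffG_of_not_mem _ hb, toC_one, mul_one,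
      Set.indicator_of_notMem (fun h => hb (Finset.mem_coe.1 h))]
    simp

/-! ## §2 (5.4.9): the split of the bracket at `Λ₃^{(k)*}`, on functions -/

/-- kernel: the curl of a bond field split by a bond cut-off, `∂A = ∂(SᶜA) + ∂(SA)`. [cite: BalabanImbrieJaffe1988, (5.4.9) p.283] -/
theorem curl_indicator_compl_add {n : ℕ} (c : ℝ) (S : Finset (PBond P n)) (A : PBond P n → ℝ) (p : Balaban1983to89.Plaq P n) :
    curl c ((↑Sᶜ : Set (PBond P n)).indicator A) p + curl c ((↑S : Set (PBond P n)).indicator A) p = curl c A p := by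
  rw [← curl_add]
  congr 1
  funext b
  simp only [Finset.coe_compl]
  rw [add_comm]
  exact congrFun (Set.indicator_self_add_compl (↑S : Set (PBond P n)) A) b

/-- **(5.4.9) ON THE TORUS** (r16's `eq549_split` + `eq549`, corrected sign of `w₅` — transcript note T8 — read on functions for the concrete
`Q^{s*}_k`).  p. 283 [PDF 27], verbatim: *"We put Λ̄₂^{(k)*}(Q^{s*}_k − 𝒟_{k,loc}∂*Q^{e*}_k∂)A′ = Λ̄₂^{(k)*}(Q^{s*}_k − 𝒟_{k,loc}∂*Q^{e*}_k∂)Λ₃^{(k)*c}A′ +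
(Q^{s*}_k − 𝒟_{k,loc}∂*Q^{e*}_k∂)Λ₃^{(k)*}A′ = Λ̄₂^{(k)*}(Q^{s*}_k − 𝒟_{k,loc}∂*Q^{e*}_k∂)Λ₃^{(k)*c}A′ + H_{k,loc}Λ₃^{(k)*}A′ + ∂C_kΛ₃^{(k)*}A′ + w₅A′.
(5.4.9) Here w₅ = [(𝒟_{k,loc} − 𝒟_k)∂*Q^{e*}_k∂ + H_k − H_{k,loc}]Λ₃^{(k)*}"* [sic: `(𝒟_k − 𝒟_{k,loc})`, r16's `w5`].  DATA as in
`BIJ88Eq542Torus.eq544_torus`; `Λ₃^{(k)*}` = a unit-lattice bond set `S`, `Λ̄₂^{(k)*}` = an η-bond set `Λ₂s`; HYPOTHESES `h541` = (5.4.1) and the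
RANGE LAW `hrange`: `(Q^{s*}_k − T_loc∂)(Λ₃*A′)` vanishes off `Λ̄₂*` (r16's `Λ̄₂XΛ₃ = XΛ₃`; derivable from a range relation: `rangeLaw_of_range`).
CONCLUSION at every η-bond, with `w₅A′ = (T_k − T_loc)∂(Λ₃*A′) + (H_k − H_{k,loc})(Λ₃*A′)` spelled out. [cite: BalabanImbrieJaffe1988, (5.4.9) p.283] -/
theorem eq549_torus {k : ℕ} (hk : i + k ≤ P.m + P.K) {η : ℝ} (Tk Tloc : (Balaban1983to89.Plaq P (i + k) → ℝ) →ₗ[ℝ] (PBond P i → ℝ))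
    (Hk Hloc : (PBond P (i + k) → ℝ) →ₗ[ℝ] (PBond P i → ℝ)) (Ck : (PBond P (i + k) → ℝ) →ₗ[ℝ] (Balaban1983to89.Site P i → ℝ))
    (h541 : ∀ (A : PBond P (i + k) → ℝ) (b : PBond P i),
      (torusBlockBondsIter P i k).Qsstar A b - Tk (curl 1 A) b = Hk A b + grad η⁻¹ (Ck A) b)
    (S : Finset (PBond P (i + k))) (Λ₂s : Finset (PBond P i)) (A' : PBond P (i + k) → ℝ)
    (hrange : ∀ b ∉ Λ₂s, (torusBlockBondsIter P i k).Qsstar ((↑S : Set (PBond P (i + k))).indicator A') b -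
      Tloc (curl 1 ((↑S : Set (PBond P (i + k))).indicator A')) b = 0) (b : PBond P i) :
    (↑Λ₂s : Set (PBond P i)).indicator (fun b => (torusBlockBondsIter P i k).Qsstar A' b - Tloc (curl 1 A') b) b =
      (↑Λ₂s : Set (PBond P i)).indicator (fun b => (torusBlockBondsIter P i k).Qsstar ((↑Sᶜ : Set (PBond P (i + k))).indicator A') b -
          Tloc (curl 1 ((↑Sᶜ : Set (PBond P (i + k))).indicator A')) b) b +
        (Hloc ((↑S : Set (PBond P (i + k))).indicator A') b + grad η⁻¹ (Ck ((↑S : Set (PBond P (i + k))).indicator A')) b +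
          ((Tk (curl 1 ((↑S : Set (PBond P (i + k))).indicator A')) b - Tloc (curl 1 ((↑S : Set (PBond P (i + k))).indicator A')) b) +
            (Hk ((↑S : Set (PBond P (i + k))).indicator A') b - Hloc ((↑S : Set (PBond P (i + k))).indicator A') b))) := by
  -- the `Λ₃*` part through (5.4.1)
  have h3 := h541 ((↑S : Set (PBond P (i + k))).indicator A') b
  -- split `A′ = Λ₃^{*c}A′ + Λ₃*A′` through `Q^{s*}_k` and through `T_loc∂`
  have hQ := Qsstar_indicator_compl_add hk S A' b
  have hC : Tloc (curl 1 ((↑Sᶜ : Set (PBond P (i + k))).indicator A')) b + Tloc (curl 1 ((↑S : Set (PBond P (i + k))).indicator A')) b =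
      Tloc (curl 1 A') b := by
    have hsum : curl 1 ((↑Sᶜ : Set (PBond P (i + k))).indicator A') + curl 1 ((↑S : Set (PBond P (i + k))).indicator A') =
        curl 1 A' := funext (curl_indicator_compl_add 1 S A')
    rw [← Pi.add_apply, ← map_add, hsum]
  by_cases hb : b ∈ Λ₂s
  · rw [Set.indicator_of_mem (Finset.mem_coe.2 hb), Set.indicator_of_mem (Finset.mem_coe.2 hb)]
    linarith
  · rw [Set.indicator_of_notMem (fun h => hb (Finset.mem_coe.1 h)), Set.indicator_of_notMem (fun h => hb (Finset.mem_coe.1 h))]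
    have h0 := hrange b hb
    linarith

/-- **The range law `hrange` DERIVED from a range relation** (r16's hypothesis `Λ̄₂^{(k)*}XΛ₃^{(k)*} = XΛ₃^{(k)*}` of `eq549_split`): if `(T F)(b)`
depends only on the plaquettes `near b` (RANGE of `T_loc = 𝒟_{k,loc}∂*Q^{e*}_k`), and for `b ∉ Λ̄₂*` no plaquette near `b` has a bond in `Λ₃*` and the
k-block bond of `b` is not in `Λ₃*` (`Λ₃` lies inside `Λ₂` beyond the range — the p. 274 collars), then `(Q^{s*}_k − T_loc∂)(Λ₃*A′)` vanishes
off `Λ̄₂*` (standing range). [cite: BalabanImbrieJaffe1988, (5.4.9) p.283] -/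
theorem rangeLaw_of_range {k : ℕ} (hk : i + k ≤ P.m + P.K) (Tloc : (Balaban1983to89.Plaq P (i + k) → ℝ) →ₗ[ℝ] (PBond P i → ℝ))
    (near : PBond P i → Balaban1983to89.Plaq P (i + k) → Prop)
    (hT : ∀ (F₁ F₂ : Balaban1983to89.Plaq P (i + k) → ℝ) (b : PBond P i), (∀ p, near b p → F₁ p = F₂ p) → Tloc F₁ b = Tloc F₂ b)
    (S : Finset (PBond P (i + k))) (Λ₂s : Finset (PBond P i))
    (hfarQ : ∀ b ∉ Λ₂s, (⟨blockOfIter k b.src, b.dir⟩ : PBond P (i + k)) ∉ S)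
    (hfarT : ∀ b ∉ Λ₂s, ∀ p, near b p → (⟨p.src, p.μ⟩ : PBond P (i + k)) ∉ S ∧ (⟨p.src.shift p.μ, p.ν⟩ : PBond P (i + k)) ∉ S ∧
      (⟨p.src.shift p.ν, p.μ⟩ : PBond P (i + k)) ∉ S ∧ (⟨p.src, p.ν⟩ : PBond P (i + k)) ∉ S)
    (A' : PBond P (i + k) → ℝ) (b : PBond P i) (hb : b ∉ Λ₂s) :
    (torusBlockBondsIter P i k).Qsstar ((↑S : Set (PBond P (i + k))).indicator A') b -
      Tloc (curl 1 ((↑S : Set (PBond P (i + k))).indicator A')) b = 0 := by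
  rw [Qsstar_indicator hk, if_neg (hfarQ b hb)]
  have hcurl : Tloc (curl 1 ((↑S : Set (PBond P (i + k))).indicator A')) b = Tloc (curl 1 (fun _ => (0 : ℝ))) b := by
    refine hT _ _ b fun p hp => ?_
    obtain ⟨h1, h2, h3, h4⟩ := hfarT b hb p hp
    simp only [curl, Set.indicator_of_notMem (fun h => h1 (Finset.mem_coe.1 h)), Set.indicator_of_notMem (fun h => h2 (Finset.mem_coe.1 h)),
      Set.indicator_of_notMem (fun h => h3 (Finset.mem_coe.1 h)), Set.indicator_of_notMem (fun h => h4 (Finset.mem_coe.1 h))]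
  have h0 : curl 1 (fun _ : PBond P (i + k) => (0 : ℝ)) = 0 := by
    funext p
    simp [curl]
  rw [hcurl, h0, map_zero, Pi.zero_apply, sub_zero]

/-! ## §3 (5.4.10): the background gauge field for the normalization factors -/

/-- **(5.4.10) ON THE TORUS.**  p. 283 [PDF 27], verbatim: *"We can gauge away the term ∂C_kΛ₃^{(k)*}A′, leaving us with the following background
gauge field for the normalization factors: (Λ̄₂^{(k)*c}u_k)(Λ̄₂^{(k)*}Q^{s*}_{k+1}v) exp ie_kη[Λ̄₂^{(k)*}(Q^{s*}_k − 𝒟_{k,loc}∂Q^{e*}_k∂)Λ₃^{(k)*c}A′ −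
L^{−2}Λ̄₂^{(k)*}𝒟_{k,loc}∂*Q^{e*}_{k+1}f + H_{k,loc}Λ₃^{(k)*}A′ + w₅A′]. (5.4.10) The term w₅A′ will be removed later on; it couples A′ to bonds everywhere
in T_η."*  HERE: the (4.16) background gauge transformation `bgGaugeU` (r18) with the NONLOCAL gauge function `λ = C_k(Λ₃*A′)` (p. 283: *"we must
resign from a local form of the gauge transformation"*) applied to the field (5.4.8) (`eq548_torus`, hypotheses as there), with (5.4.9) inserted
(`eq549_torus`: hypotheses `h541`, `hrange`): at EVERY η-bond `b` the transformed field equals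
`(Λ̄₂^{*c}u_k)(b) · (Λ̄₂^{*}Q^{s*}_{k+1}v)(b) · exp ie_kη[Λ̄₂^{*}((Q^{s*}_k − T_loc∂)(Λ₃^{*c}A′))(b) − L^{−2}Λ̄₂^{*}(T_loc(Q^{e*}f))(b) + (H_{k,loc}(Λ₃*A′))(b) +
(w₅A′)(b)]`, `w₅A′` as in `eq549_torus` (standing range). [cite: BalabanImbrieJaffe1988, (5.4.10) p.283] -/
theorem eq5410_torus {k : ℕ} (hk : i + k + 1 ≤ P.m + P.K) {ek η : ℝ} (hη : η * (P.L : ℝ) ^ k = 1)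
    (X : Finset (Balaban1983to89.Site P (i + k + 1))) {u' : GaugeField P (i + k) U1} {A' : PBond P (i + k) → ℝ}
    (hu : ∀ c ∈ starB (blockUnion 1 X), u' c = expU1 (ek * A' c)) (v : GaugeField P (i + k + 1) U1) (g : PBond P i → ℝ)
    {Plc : Type*} (L : ℝ) (Tk Tloc : (Balaban1983to89.Plaq P (i + k) → ℝ) →ₗ[ℝ] (PBond P i → ℝ))
    (Hk Hloc : (PBond P (i + k) → ℝ) →ₗ[ℝ] (PBond P i → ℝ)) (Ck : (PBond P (i + k) → ℝ) →ₗ[ℝ] (Balaban1983to89.Site P i → ℝ))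
    (h541 : ∀ (A : PBond P (i + k) → ℝ) (b : PBond P i),
      (torusBlockBondsIter P i k).Qsstar A b - Tk (curl 1 A) b = Hk A b + grad η⁻¹ (Ck A) b)
    (Qes : (Plc → ℝ) →ₗ[ℝ] (Balaban1983to89.Plaq P (i + k) → ℝ)) (f : Plc → ℝ)
    (X₂ : Finset (Balaban1983to89.Site P (i + k + 1))) (hX₂ : X₂ ⊆ X)
    (hT : ∀ b ∈ starB (blockUnion (k + 1) X₂), g b = Tloc (curl 1 A' + L⁻¹ ^ 2 • Qes f) b)
    (S : Finset (PBond P (i + k)))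
    (hrange : ∀ b ∉ starB (blockUnion (k + 1) X₂), (torusBlockBondsIter P i k).Qsstar ((↑S : Set (PBond P (i + k))).indicator A') b -
      Tloc (curl 1 ((↑S : Set (PBond P (i + k))).indicator A')) b = 0) (b : PBond P i) :
    bgGaugeU ek η (Ck ((↑S : Set (PBond P (i + k))).indicator A'))
        (backgroundU ek η (fun b => toC (qsstarGIter k (surfMul u' (cutoff (starB X) v)) b)) g) b =
      cutoffG (starB (blockUnion (k + 1) X₂))ᶜ
          (backgroundU ek η (fun b => toC (qsstarGIter k (surfMul u' (cutoff (starB X) v)) b)) g) b *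
        toC (cutoffG (starB (blockUnion (k + 1) X₂)) (qsstarGIter (k + 1) v) b) *
        Complex.exp (I * ((ek * η *
          ((↑(starB (blockUnion (k + 1) X₂)) : Set (PBond P i)).indicator
              (fun b => (torusBlockBondsIter P i k).Qsstar ((↑Sᶜ : Set (PBond P (i + k))).indicator A') b -
                Tloc (curl 1 ((↑Sᶜ : Set (PBond P (i + k))).indicator A')) b) b -
            L⁻¹ ^ 2 * (↑(starB (blockUnion (k + 1) X₂)) : Set (PBond P i)).indicator (fun b => Tloc (Qes f) b) b +
            Hloc ((↑S : Set (PBond P (i + k))).indicator A') b +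
            ((Tk (curl 1 ((↑S : Set (PBond P (i + k))).indicator A')) b - Tloc (curl 1 ((↑S : Set (PBond P (i + k))).indicator A')) b) +
              (Hk ((↑S : Set (PBond P (i + k))).indicator A') b - Hloc ((↑S : Set (PBond P (i + k))).indicator A') b))) : ℝ) : ℂ)) := by
  have h548 := eq548_torus hk hη X hu v g L Tloc Qes f X₂ hX₂ hT b
  have h549 := eq549_torus (i := i) (k := k) (by omega) Tk Tloc Hk Hloc Ck h541 S (starB (blockUnion (k + 1) X₂)) A' hrange b
  -- the bracket of (5.4.8) is `(Q^{s*}_k − T_loc∂)A′ − L⁻²T_loc(Q^{e*}f)`, cut off to `Λ̄₂*`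
  have hbr : (↑(starB (blockUnion (k + 1) X₂)) : Set (PBond P i)).indicator
        (fun b => (torusBlockBondsIter P i k).Qsstar A' b - Tloc (curl 1 A' + L⁻¹ ^ 2 • Qes f) b) b =
      (↑(starB (blockUnion (k + 1) X₂)) : Set (PBond P i)).indicator
          (fun b => (torusBlockBondsIter P i k).Qsstar A' b - Tloc (curl 1 A') b) b -
        L⁻¹ ^ 2 * (↑(starB (blockUnion (k + 1) X₂)) : Set (PBond P i)).indicator (fun b => Tloc (Qes f) b) b := by
    by_cases hb : b ∈ starB (blockUnion (k + 1) X₂)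
    · simp only [Set.indicator_of_mem (Finset.mem_coe.2 hb), map_add, map_smul, Pi.add_apply, Pi.smul_apply, smul_eq_mul]
      ring
    · simp only [Set.indicator_of_notMem (fun h => hb (Finset.mem_coe.1 h))]
      ring
  -- the real identity of the exponents
  have key : ek * η * (↑(starB (blockUnion (k + 1) X₂)) : Set (PBond P i)).indicator
        (fun b => (torusBlockBondsIter P i k).Qsstar A' b - Tloc (curl 1 A' + L⁻¹ ^ 2 • Qes f) b) b +
      -(ek * η * grad η⁻¹ (Ck ((↑S : Set (PBond P (i + k))).indicator A')) b) =
      ek * η *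
        ((↑(starB (blockUnion (k + 1) X₂)) : Set (PBond P i)).indicator
            (fun b => (torusBlockBondsIter P i k).Qsstar ((↑Sᶜ : Set (PBond P (i + k))).indicator A') b -
              Tloc (curl 1 ((↑Sᶜ : Set (PBond P (i + k))).indicator A')) b) b -
          L⁻¹ ^ 2 * (↑(starB (blockUnion (k + 1) X₂)) : Set (PBond P i)).indicator (fun b => Tloc (Qes f) b) b +
          Hloc ((↑S : Set (PBond P (i + k))).indicator A') b +
          ((Tk (curl 1 ((↑S : Set (PBond P (i + k))).indicator A')) b - Tloc (curl 1 ((↑S : Set (PBond P (i + k))).indicator A')) b) +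
            (Hk ((↑S : Set (PBond P (i + k))).indicator A') b - Hloc ((↑S : Set (PBond P (i + k))).indicator A') b))) := by
    rw [hbr, h549]
    ring
  have keyC := congrArg (fun r : ℝ => (r : ℂ)) key
  simp only [bgGaugeU]
  rw [h548, mul_assoc, ← Complex.exp_add]
  congr 1
  congr 1
  push_cast at keyC ⊢
  linear_combination I * keyC

end

end Literature.MathematicalPhysics.QuantumFieldTheory.BalabanImbrieJaffe1984to88.BIJ88Eq5410Torus
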